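import Mathlib
import Summits.Ventures.HodgeRepro.Tier4.Line4.ProjectedTest

/-!
# Tier4/Line4/ProjectedTestList — the COMPOSITE bi-projector along a list of pairwise commuting compact subgroups:
a test function `e ⋆ f ⋆ e` equivariant under EVERY `(C, χ)` of the list at once

Blind re-derivation cell `pub-hodge-repro`, Tier 4 «prove the step» (README §9–§10), seat t4-L4-p2 (prover, LINE L4,
gen 3; plan-4's cut C-L4-PROJ S13921 / S13948, the test-function side, second module). Tree path
`lean/Summits/Ventures/HodgeRepro/Tier4/Line4/ProjectedTestList.lean`. Mathlib-level; no literature. Input: this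
seat's `Line4/ProjectedTest` (`kProj` of a test function is a test function; `kProjL`, `biProj` and their equivariances).

* `ProjDatum G` — a compact subgroup `C`, a measure `ν` on it, a character `χ` on `G`; `biProjList l f` — the
  bi-projectors of the list applied one after the other (`[]` = `f`);
* passing lemmas: left-equivariance (inverse form) passes through `kProjL` and right-equivariance through `kProj`
  when the translating element COMMUTES with the projecting subgroup (`kProjL_apply_inv_mul_of_commute`,
  `kProj_apply_mul_of_commute`); through the other projector no commutation is needed (`ProjectedTest`);
* **`isTest_biProjList`** (a test function stays a test function), **`biProjList_apply_inv_mul`** and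
  **`biProjList_apply_mul`**: for a list whose subgroups pairwise commute elementwise (`List.Pairwise`), with every
  `χ` multiplicative and unitary on its `C`, every `ν` left invariant, the output satisfies, for EVERY datum `d` of the
  list, `f₁ (κ⁻¹ y) = d.χ κ · f₁ y` and `f₁ (z κ) = conj (d.χ κ) · f₁ z` for `κ ∈ d.C`.
With the data `(localTorusAt' W w, ν_w, conj ∘ weight′_w)` over the infinite places and `(K, ν_K, 1)` (commuting by
typer-2's `PlaceCommute`), `biProjList` produces the test pair of the re-typed residual (b″): `cj f₁` and `refl f₂`
left-`(τ′,K)`-equivariant, so `R(f̄₁) φ`, `R(f₂ˇ) φ` land in `kTypeSpace'` by L4-p1's `rightRegular_mem_kTypeSpace'`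
(the stability clauses `hst₁`, `hst₂` of C-L4-2VEC) — the assembly on `GA W` is the next module.

Nothing here says anything about the status of the Hodge conjecture for CM abelian varieties, which is NOT proved
(HC_CM is NOT proved by anyone in this repository).
-/

set_option autoImplicit false

noncomputable section

namespace Summit.Ventures.HodgeRepro.Tier4.Line4

open Summit.Ventures.HodgeRepro.Tier4.Common Summit.Ventures.HodgeRepro.Tier4.Line1 MeasureTheory
open scoped ComplexConjugate

section Passing

variable {G : Type} [Group G] [TopologicalSpace G] [IsTopologicalGroup G] [MeasurableSpace G] [BorelSpace G]
  (C : Subgroup G) (ν : Measure C)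

omit [TopologicalSpace G] [IsTopologicalGroup G] [BorelSpace G] in
/-- **Right-equivariance passes through the right projector when the translating element commutes with `C`**:
`ψ (z κ₀) = c ψ z` for all `z` and `κ₀ κ = κ κ₀` for `κ ∈ C` give `e_{C,χ} ψ (x κ₀) = c · e_{C,χ} ψ x`. -/
theorem kProj_apply_mul_of_commute {χ ψ : G → ℂ} {κ₀ : G} {c : ℂ} (h : ∀ z, ψ (z * κ₀) = c * ψ z)
    (hcomm : ∀ κ ∈ C, κ₀ * κ = κ * κ₀) (x : G) : kProj C ν χ ψ (x * κ₀) = c * kProj C ν χ ψ x := by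
  simp only [kProj]
  rw [← integral_const_mul]
  congr 1
  funext κ
  rw [mul_assoc, hcomm κ κ.2, ← mul_assoc, h (x * κ)]
  ring

omit [TopologicalSpace G] [IsTopologicalGroup G] [BorelSpace G] in
/-- **Left-equivariance (inverse form) passes through the left projector when the translating element commutes with
`C`**: `ψ (κ₀⁻¹ y) = c ψ y` for all `y` and `κ₀ κ = κ κ₀` for `κ ∈ C` give `e^L_{C,χ} ψ (κ₀⁻¹ y) = c · e^L_{C,χ} ψ y`. -/
theorem kProjL_apply_inv_mul_of_commute {χ ψ : G → ℂ} {κ₀ : G} {c : ℂ} (h : ∀ y, ψ (κ₀⁻¹ * y) = c * ψ y)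
    (hcomm : ∀ κ ∈ C, κ₀ * κ = κ * κ₀) (y : G) : kProjL C ν χ ψ (κ₀⁻¹ * y) = c * kProjL C ν χ ψ y := by
  have h' : ∀ z, RTF.refl ψ (z * κ₀) = c * RTF.refl ψ z := by
    intro z
    simp only [RTF.refl, mul_inv_rev]
    exact h z⁻¹
  show kProj C ν χ (RTF.refl ψ) (κ₀⁻¹ * y)⁻¹ = c * kProj C ν χ (RTF.refl ψ) y⁻¹
  rw [mul_inv_rev, inv_inv]
  exact kProj_apply_mul_of_commute C ν h' hcomm y⁻¹

omit [TopologicalSpace G] [IsTopologicalGroup G] [BorelSpace G] in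
/-- Left-equivariance (inverse form) passes through the right projector (no commutation needed). -/
theorem kProj_apply_inv_mul_left {χ ψ : G → ℂ} {κ₀ : G} {c : ℂ} (h : ∀ y, ψ (κ₀⁻¹ * y) = c * ψ y) (x : G) :
    kProj C ν χ ψ (κ₀⁻¹ * x) = c * kProj C ν χ ψ x :=
  kProj_apply_mul_left C ν h x

omit [TopologicalSpace G] [IsTopologicalGroup G] [BorelSpace G] in
/-- Both equivariances of a datum pass through the bi-projector of a COMMUTING datum. -/
theorem biProj_apply_inv_mul_of_commute {χ ψ : G → ℂ} {κ₀ : G} {c : ℂ} (h : ∀ y, ψ (κ₀⁻¹ * y) = c * ψ y)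
    (hcomm : ∀ κ ∈ C, κ₀ * κ = κ * κ₀) (y : G) : biProj C ν χ ψ (κ₀⁻¹ * y) = c * biProj C ν χ ψ y :=
  kProjL_apply_inv_mul_of_commute C ν (fun y' => kProj_apply_inv_mul_left C ν h y') hcomm y

omit [TopologicalSpace G] [IsTopologicalGroup G] [BorelSpace G] in
/-- Right-equivariance passes through the bi-projector of a COMMUTING datum. -/
theorem biProj_apply_mul_of_commute {χ ψ : G → ℂ} {κ₀ : G} {c : ℂ} (h : ∀ z, ψ (z * κ₀) = c * ψ z)
    (hcomm : ∀ κ ∈ C, κ₀ * κ = κ * κ₀) (z : G) : biProj C ν χ ψ (z * κ₀) = c * biProj C ν χ ψ z :=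
  kProjL_apply_mul_right C ν (fun z' => kProj_apply_mul_of_commute C ν h hcomm z') z

end Passing

section ListComposite

variable {G : Type} [Group G] [TopologicalSpace G] [IsTopologicalGroup G] [MeasurableSpace G] [BorelSpace G]

/-- **A projection datum**: a subgroup `C`, a measure `ν` on it and a character `χ` on `G`. -/
structure ProjDatum (G : Type) [Group G] [TopologicalSpace G] [MeasurableSpace G] where
  /-- the (compact) subgroup -/
  C : Subgroup G
  /-- a (Haar probability) measure on it -/
  ν : Measure C
  /-- the character, read on `C` -/
  χ : G → ℂ

/-- The composite bi-projector along a list of data. -/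
def biProjList : List (ProjDatum G) → (G → ℂ) → G → ℂ
  | [], f => f
  | d :: l, f => biProj d.C d.ν d.χ (biProjList l f)

/-- The good data: compact subgroup, finite left-invariant measure, continuous multiplicative unitary character. -/
structure ProjDatum.Good (d : ProjDatum G) : Prop where
  compact : IsCompact (d.C : Set G)
  finite : IsFiniteMeasure d.ν
  leftInv : d.ν.IsMulLeftInvariant
  cont : Continuous fun κ : d.C => d.χ κ
  mul : ∀ a ∈ d.C, ∀ b ∈ d.C, d.χ (a * b) = d.χ a * d.χ b
  unit : ∀ a ∈ d.C, ‖d.χ a‖ = 1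

/-- Two data commute elementwise. -/
def ProjDatum.Commutes (d d' : ProjDatum G) : Prop := ∀ a ∈ d.C, ∀ b ∈ d'.C, a * b = b * a

omit [IsTopologicalGroup G] [BorelSpace G] in
/-- Commutation is symmetric. -/
theorem ProjDatum.Commutes.symm {d d' : ProjDatum G} (h : d.Commutes d') : d'.Commutes d :=
  fun b hb a ha => (h a ha b hb).symm

/-- **The composite of a test function is a test function** (every datum good). -/
theorem isTest_biProjList [LocallyCompactSpace G] [FirstCountableTopology G] (l : List (ProjDatum G))
    (hl : ∀ d ∈ l, d.Good) {f : G → ℂ} (hf : RTF.IsTest f) : RTF.IsTest (biProjList l f) := by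
  induction l with
  | nil => exact hf
  | cons d l ih =>
    have hd : d.Good := hl d (List.mem_cons_self ..)
    haveI : CompactSpace d.C := isCompact_iff_compactSpace.1 hd.compact
    haveI : IsFiniteMeasure d.ν := hd.finite
    exact isTest_biProj d.C d.ν hd.cont (ih fun d' hd' => hl d' (List.mem_cons_of_mem _ hd'))

/-- **Left-equivariance of the composite for EVERY datum of the list** (pairwise commuting data, all good):
`biProjList l f (κ⁻¹ y) = d.χ κ · biProjList l f y` for `d ∈ l`, `κ ∈ d.C`. -/
theorem biProjList_apply_inv_mul (l : List (ProjDatum G)) (hl : ∀ d ∈ l, d.Good)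
    (hcomm : l.Pairwise ProjDatum.Commutes) (f : G → ℂ) {d : ProjDatum G} (hd : d ∈ l) (y : G) {κ : G}
    (hκ : κ ∈ d.C) : biProjList l f (κ⁻¹ * y) = d.χ κ * biProjList l f y := by
  induction l generalizing y with
  | nil => simp at hd
  | cons d₀ l ih =>
    have hd₀ : d₀.Good := hl d₀ (List.mem_cons_self ..)
    haveI : d₀.ν.IsMulLeftInvariant := hd₀.leftInv
    rcases List.mem_cons.1 hd with rfl | hd'
    · exact biProj_apply_inv_mul d.C d.ν hd₀.mul hd₀.unit _ y hκ
    · have hl' : ∀ d' ∈ l, d'.Good := fun d' hd'' => hl d' (List.mem_cons_of_mem _ hd'')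
      have hcomm' : l.Pairwise ProjDatum.Commutes := hcomm.of_cons
      have hc : d₀.Commutes d := (List.pairwise_cons.1 hcomm).1 d hd'
      exact biProj_apply_inv_mul_of_commute d₀.C d₀.ν (fun y' => ih hl' hcomm' hd' y')
        (fun κ' hκ' => (hc κ' hκ' κ hκ).symm) y

/-- **Right-equivariance of the composite for EVERY datum of the list**:
`biProjList l f (z κ) = conj (d.χ κ) · biProjList l f z` for `d ∈ l`, `κ ∈ d.C`. -/
theorem biProjList_apply_mul (l : List (ProjDatum G)) (hl : ∀ d ∈ l, d.Good)
    (hcomm : l.Pairwise ProjDatum.Commutes) (f : G → ℂ) {d : ProjDatum G} (hd : d ∈ l) (z : G) {κ : G}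
    (hκ : κ ∈ d.C) : biProjList l f (z * κ) = conj (d.χ κ) * biProjList l f z := by
  induction l generalizing z with
  | nil => simp at hd
  | cons d₀ l ih =>
    have hd₀ : d₀.Good := hl d₀ (List.mem_cons_self ..)
    haveI : d₀.ν.IsMulLeftInvariant := hd₀.leftInv
    rcases List.mem_cons.1 hd with rfl | hd'
    · exact biProj_apply_mul d.C d.ν hd₀.mul hd₀.unit _ z hκ
    · have hl' : ∀ d' ∈ l, d'.Good := fun d' hd'' => hl d' (List.mem_cons_of_mem _ hd'')
      have hcomm' : l.Pairwise ProjDatum.Commutes := hcomm.of_cons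
      have hc : d₀.Commutes d := (List.pairwise_cons.1 hcomm).1 d hd'
      exact biProj_apply_mul_of_commute d₀.C d₀.ν (fun z' => ih hl' hcomm' hd' z')
        (fun κ' hκ' => (hc κ' hκ' κ hκ).symm) z

end ListComposite

end Summit.Ventures.HodgeRepro.Tier4.Line4

end
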